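import Mathlib
import Literature.Computability.AlgebraicComplexity.ASSS16LevelRecursion
import Literature.Computability.AlgebraicComplexity.ASSS16DescentFaithful
import HarnessLib

/-!
# [ASSS16] §4, the step of the levels recursion — "factor" half: a map faithful one level down
# keeps the Jacobian minors of this level non-zero

Agrawal–Saha–Saptharishi–Saxena, *Jacobian hits circuits* [ASSS16] (arXiv:1111.0582), §4, between
Lemma 4.2 and Cor. 4.3 (locator: paper:arxiv-1111.0582 p0010.txt:L22–L33): "The collection `𝒞_{ℓ+1}`
is formed from `𝒞_ℓ` using the above lemma: `V_i` is a polynomial in a set of derivatives of gates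
at the `(ℓ+1)`-th level — denote this set of derivatives by `Elem(V_i)` … Using Lemma
(lem:composition-lemma) & (lem:descent-jacobian), we can lift a map `Ψ_{ℓ+1}` to construct `Ψ_ℓ`."
The lifting itself is Cor. 4.3 (`ASSS16.descentFaithful`, val-lit p2); its hypothesis is that
`Ψ_{ℓ+1}` keeps a non-zero `|𝒰'| × |𝒰'|` Jacobian minor non-zero, and THIS file supplies that
hypothesis from the induction invariant one level down: by Lemma 4.2 (`ASSS16.descentJacobian`,
val-lit t19) the minor is `(∏_j K_j^{e_j}) · V` with `V ∈ 𝔽[Elem(V)]`, `|Elem(V)| ≤ r_{ℓ+1}`, and a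
map faithful (in Thm. 2.1 form) to every admissible family of the next level keeps `V` and the
non-zero `K_j` non-zero (`ASSS16.map_prod_pow_mul_ne_zero_of_faithful`, p2).

* `ASSS16.map_levelMinor_ne_zero_of_nextLevel` — the factor half of the step, generic in the map
  `Ψ` (an `𝔽`-algebra map into any polynomial ring) and in the variable type;
* `ASSS16.map_levelMinor_ne_zero_of_nextLevel_asssRec` — the same in the bookkeeping of F1's
  recursion `asssRec` (family size `≤ r_{2+c}`, next level `≤ r_{2+c+1}`, injective rows);
* `ASSS16.map_levelMinor_ne_zero_of_inv_succ` — the same with the level indexed as in the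
  keystone's invariant: block index `j` (orders `≤ j`, depth `≤ D - 1 - j`, `j + 4 ≤ D`), next
  level `j + 1` (orders `≤ j + 1`, depth `≤ D - 1 - (j + 1)`), no arithmetic side conditions.

Theorem-only; no definitions, no named facts. Honest framing: glue for the val-lit N1 chain
(`FSV2018_thm48_topFanIn`); `VP ≠ VNP` is NOT proved and nothing here bears on it.

## References
* [AgrawalEtAl2011] arXiv:1111.0582 §4, Lemma 4.2 / Cor. 4.3 and the paragraph between them —
  locator: paper:arxiv-1111.0582 p0010.txt:L12–L46.
-/

noncomputable section

namespace Literature.Computability.AlgebraicComplexity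

namespace ASSS16

open MvPolynomial Finset

open Literature.RepresentationTheory.AlgebraicGroups (iterPderiv iterPderiv_zero)

variable {F : Type*} [Field F] {ι σ : Type*} [DecidableEq ι]

/-- **The step of [ASSS16] §4's recursion, factor half.** Suppose `Ψ` is faithful — in Thm. 2.1
form `Q(W) ≠ 0 ↔ Q(Ψ W) ≠ 0` — to every family `W` of at most `rnext` derivatives of orders `≤ c + 1`
of occur formulas with occur `≤ k`, size `≤ s`, depth `≤ d - 1` (the induction invariant at the next
level, `rnext ≥ (c+1)·2^{c+1}·k·ρ²`, and `rnext ≥ 1` once the minor is non-empty and `k ≥ 1`; `d ≥ 3` so that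
persisting leaves, of depth `2`, belong to the next level). Then `Ψ` keeps every non-zero `ρ × ρ`
Jacobian minor of a family `U_u = Δ_{T_u} G_u` of THIS level (orders `≤ c`, depth `≤ d`) non-zero:
"`Ψ_{ℓ+1}` is faithful to `𝒞_{ℓ+1}`" ⇒ `Ψ_{ℓ+1}(det M) = ∏ Ψ_{ℓ+1}(V_G)^{e_G} · Ψ_{ℓ+1}(V) ≠ 0`,
which is the input of Cor. 4.3 (`ASSS16.descentFaithful`).
[cite: AgrawalEtAl2011, §4 (Lemma 4.2, Cor. 4.3 and the paragraph between)]
locator: paper:arxiv-1111.0582 p0010.txt:L12–L46 -/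
theorem map_levelMinor_ne_zero_of_nextLevel {k s d c m ρ rnext : ℕ}
    (Ψ : MvPolynomial ι F →ₐ[F] MvPolynomial σ F)
    (hINV : ∀ (m' : ℕ) (H : Fin m' → OccurFormula F ι) (T' : Fin m' → ι →₀ ℕ), m' ≤ rnext →
      (∀ u i, (H u).occur i ≤ k) → (∀ u, (H u).size ≤ s) → (∀ u, (H u).depth ≤ d - 1) →
      (∀ u, (T' u).degree ≤ c + 1) → ∀ Q : MvPolynomial (Fin m') F,
        aeval (fun u => iterPderiv (A := F) (T' u) (H u).eval) Q ≠ 0 ↔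
          aeval (fun u => Ψ (iterPderiv (A := F) (T' u) (H u).eval)) Q ≠ 0)
    (hd3 : 3 ≤ d) (hnext : (c + 1) * 2 ^ (c + 1) * k * ρ ^ 2 ≤ rnext)
    (hnext1 : 1 ≤ ρ → 1 ≤ k → 1 ≤ rnext)
    (G : Fin m → OccurFormula F ι) (T : Fin m → ι →₀ ℕ)
    (hk : ∀ u i, (G u).occur i ≤ k) (hs : ∀ u, (G u).size ≤ s) (hd : ∀ u, (G u).depth ≤ d)
    (hc : ∀ u, (T u).degree ≤ c) (rows : Fin ρ → Fin m) (cols : Fin ρ → ι)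
    (hdet : (Matrix.of fun u v =>
      pderiv (cols v) (iterPderiv (A := F) (T (rows u)) (G (rows u)).eval)).det ≠ 0) :
    Ψ (Matrix.of fun u v =>
      pderiv (cols v) (iterPderiv (A := F) (T (rows u)) (G (rows u)).eval)).det ≠ 0 := by
  classical
  rcases Nat.eq_zero_or_pos ρ with rfl | hρ
  · rw [Matrix.det_isEmpty, map_one]; exact one_ne_zero
  have hk1 : 1 ≤ k := one_le_of_det_ne_zero G T hk rows cols hρ hdet
  obtain ⟨mV, K, eV, m', H, T', V, hfac, hV, -, hm', hK, hH⟩ :=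
    descentJacobian G T hk hs hd hc rows cols
  rw [hfac] at hdet ⊢
  refine map_prod_pow_mul_ne_zero_of_faithful Ψ (fun j => iterPderiv (A := F) (T' j) (H j).eval)
    (fun Q hQ => ?_) (fun j => (K j).eval) eV (fun j Q hQ => ?_) hV hdet
  · exact (hINV m' H T' (hm'.trans hnext) (fun u => (hH u).1) (fun u => (hH u).2.1)
      (fun u => (hH u).2.2.1.trans (max_le (le_refl _) (by omega))) (fun u => (hH u).2.2.2) Q).mp hQ
  · have h := hINV 1 (fun _ => K j) (fun _ => 0) (hnext1 hρ hk1) (fun _ => (hK j).1)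
      (fun _ => (hK j).2.1) (fun _ => by have := (hK j).2.2; omega)
      (fun _ => by rw [map_zero]; exact Nat.zero_le _) Q
    rw [iterPderiv_zero] at h
    simp only [LinearMap.id_apply] at h
    exact h.mp hQ

/-- **The same step with the bookkeeping of F1's recursion `asssRec`** (`r_{2+j}`, `c_{2+j} = j`):
for a level at recursion index `c` (orders `≤ c`, family size `m ≤ r_{2+c}`), the invariant at index
`c + 1` (families of size `≤ r_{2+c+1}`) suffices. [cite: AgrawalEtAl2011, §4 (Lemma 4.2, Cor. 4.3 and the paragraph between)]
locator: paper:arxiv-1111.0582 p0010.txt:L12–L46 -/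
theorem map_levelMinor_ne_zero_of_nextLevel_asssRec {k t s d c m ρ : ℕ}
    (Ψ : MvPolynomial ι F →ₐ[F] MvPolynomial σ F)
    (hINV : ∀ (m' : ℕ) (H : Fin m' → OccurFormula F ι) (T' : Fin m' → ι →₀ ℕ),
      m' ≤ (asssRec k t (c + 1)).1 →
      (∀ u i, (H u).occur i ≤ k) → (∀ u, (H u).size ≤ s) → (∀ u, (H u).depth ≤ d - 1) →
      (∀ u, (T' u).degree ≤ c + 1) → ∀ Q : MvPolynomial (Fin m') F,
        aeval (fun u => iterPderiv (A := F) (T' u) (H u).eval) Q ≠ 0 ↔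
          aeval (fun u => Ψ (iterPderiv (A := F) (T' u) (H u).eval)) Q ≠ 0)
    (hd3 : 3 ≤ d) (G : Fin m → OccurFormula F ι) (T : Fin m → ι →₀ ℕ) (hm : m ≤ (asssRec k t c).1)
    (hk : ∀ u i, (G u).occur i ≤ k) (hs : ∀ u, (G u).size ≤ s) (hd : ∀ u, (G u).depth ≤ d)
    (hc : ∀ u, (T u).degree ≤ c) (rows : Fin ρ → Fin m) (hrows : Function.Injective rows)
    (cols : Fin ρ → ι)
    (hdet : (Matrix.of fun u v =>
      pderiv (cols v) (iterPderiv (A := F) (T (rows u)) (G (rows u)).eval)).det ≠ 0) :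
    Ψ (Matrix.of fun u v =>
      pderiv (cols v) (iterPderiv (A := F) (T (rows u)) (G (rows u)).eval)).det ≠ 0 := by
  have hρm : ρ ≤ m := by simpa using Fintype.card_le_of_injective rows hrows
  have hρ : ρ ≤ (asssRec k t c).1 := hρm.trans hm
  refine map_levelMinor_ne_zero_of_nextLevel Ψ hINV hd3 (level_count_le_asssRec_succ hρ)
    (fun hρ1 hk1 => ?_) G T hk hs hd hc rows cols hdet
  rw [asssRec_fst_succ]
  calc 1 = 1 * 1 * 1 * 1 ^ 2 := by norm_num
    _ ≤ (c + 1) * 2 ^ (c + 1) * k * (asssRec k t c).1 ^ 2 :=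
      Nat.mul_le_mul (Nat.mul_le_mul (Nat.mul_le_mul (by omega) Nat.one_le_two_pow) hk1)
        (Nat.pow_le_pow_left (hρ1.trans hρ) 2)


/-- **The factor half of the step, indexed as in the keystone's invariant** `INV j` (block index
`j` = printed level `j + 2`: orders `≤ j`, family size `≤ r_{2+j} = (asssRec k t j).1`, depth
`≤ D - 1 - j`): for `j + 4 ≤ D`, the invariant at `j + 1` for a map `Ψ` makes `Ψ` keep every
non-zero Jacobian minor (with injective rows) of a `j`-family non-zero.
[cite: AgrawalEtAl2011, §4 (Lemma 4.2, Cor. 4.3 and the paragraph between)]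
locator: paper:arxiv-1111.0582 p0010.txt:L12–L46 -/
theorem map_levelMinor_ne_zero_of_inv_succ {k t s D j m ρ : ℕ} (hj : j + 4 ≤ D)
    (Ψ : MvPolynomial ι F →ₐ[F] MvPolynomial σ F)
    (hINV : ∀ (m' : ℕ) (H : Fin m' → OccurFormula F ι) (T' : Fin m' → ι →₀ ℕ),
      m' ≤ (asssRec k t (j + 1)).1 →
      (∀ u i, (H u).occur i ≤ k) → (∀ u, (H u).size ≤ s) → (∀ u, (H u).depth ≤ D - 1 - (j + 1)) →
      (∀ u, (T' u).degree ≤ j + 1) → ∀ Q : MvPolynomial (Fin m') F,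
        aeval (fun u => iterPderiv (A := F) (T' u) (H u).eval) Q ≠ 0 ↔
          aeval (fun u => Ψ (iterPderiv (A := F) (T' u) (H u).eval)) Q ≠ 0)
    (G : Fin m → OccurFormula F ι) (T : Fin m → ι →₀ ℕ) (hm : m ≤ (asssRec k t j).1)
    (hk : ∀ u i, (G u).occur i ≤ k) (hs : ∀ u, (G u).size ≤ s)
    (hd : ∀ u, (G u).depth ≤ D - 1 - j) (hc : ∀ u, (T u).degree ≤ j)
    (rows : Fin ρ → Fin m) (hrows : Function.Injective rows) (cols : Fin ρ → ι)
    (hdet : (Matrix.of fun u v =>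
      pderiv (cols v) (iterPderiv (A := F) (T (rows u)) (G (rows u)).eval)).det ≠ 0) :
    Ψ (Matrix.of fun u v =>
      pderiv (cols v) (iterPderiv (A := F) (T (rows u)) (G (rows u)).eval)).det ≠ 0 :=
  map_levelMinor_ne_zero_of_nextLevel_asssRec (d := D - 1 - j) Ψ
    (fun m' H T' hm' hk' hs' hd' hc' Q => hINV m' H T' hm' hk' hs' (fun u => by
      have := hd' u; omega) hc' Q)
    (by omega) G T hm hk hs hd hc rows hrows cols hdet

end ASSS16


end Literature.Computability.AlgebraicComplexity
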